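import Mathlib
import Summits.Ventures.PercRepro2.Defs
import Summits.Ventures.PercRepro2.Independence
import Summits.Ventures.PercRepro2.Harris
import Summits.Ventures.PercRepro2.Graph
import Summits.Ventures.PercRepro2.Exploration
import Summits.Ventures.PercRepro2.FourFunctions
import Summits.Ventures.PercRepro2.Induced
import Summits.Ventures.PercRepro2.Frontier
import Summits.Ventures.PercRepro2.VdBKahn

/-!
# Lemma A: avoid-more positivity (blind cell PercRepro2, typer-1; mine-c g3
`proofs/MINEC-THEOREMS.md` Lemma A, INBOX 2026-08-23T11:03:51Z; lead g11 10:53:27Z queue)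

For a root `s`, an avoided set `T`, target sets `A, B` (events `X = {A ⊆ C(s)}`, `Y = {B ⊆ C(s)}`)
and a further set `U` to avoid, with `m_X = E_{μ₀}[X]` the conditional mean under `μ₀ = P(· ∣ R_T)`:
`E_{μ₀}[(X − m_X)(Y − m_Y); C(s) ∩ U = ∅] ≥ 0`. Cleared by `P(R_T)²` this is **`avoidMore_nonneg`**:

`0 ≤ P(R_T)² · P(X ∩ Y ∩ R_{T∪U}) − P(R_T) · [P(X ∩ R_T) P(Y ∩ R_{T∪U}) + P(Y ∩ R_T) P(X ∩ R_{T∪U})]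
     + P(X ∩ R_T) P(Y ∩ R_T) P(R_{T∪U})`,

proved by the identity `P(R_{T∪U}) · S = P(R_T)² · [P(R_{T∪U}) P(XY; R_{T∪U}) − P(X; R_{T∪U}) P(Y; R_{T∪U})]
+ (P(X; R_{T∪U}) P(R_T) − P(X; R_T) P(R_{T∪U})) (P(Y; R_{T∪U}) P(R_T) − P(Y; R_T) P(R_{T∪U}))`: the first
bracket is `vdBK` with the avoided set `T ∪ U`, both factors of the second are `≤ 0` by `vdBK` with the
avoided sets `(T ∪ U, T)` (monotonicity of BHK 1.3 in the avoided set); `P(R_{T∪U}) = 0` is degenerate.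
-/

namespace Summit.Ventures.PercRepro2

namespace MineCLemmas

variable {V : Type*} {E : Type*} [Fintype E] [DecidableEq E] [Fintype V] [DecidableEq V]
  {R : Type*} [Field R] [LinearOrder R] [IsStrictOrderedRing R]

variable (p : E → R) (ends : E → Sym2 V)

omit [Fintype E] [DecidableEq E] [Fintype V] [LinearOrder R] [IsStrictOrderedRing R] in
/-- `{A ∪ B ⊆ C(s)} = {A ⊆ C(s)} ∩ {B ⊆ C(s)}`. -/
lemma connAll_union' (s : V) (A B : Finset V) :
    connAll ends s (A ∪ B) = connAll ends s A ∩ connAll ends s B := by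
  ext ω
  simp only [connAll, Set.mem_setOf_eq, Set.mem_inter_iff, Finset.mem_union, or_imp, forall_and]

omit [Fintype E] [DecidableEq E] [Fintype V] [DecidableEq V] [LinearOrder R] [IsStrictOrderedRing R] in
/-- `{∅ ⊆ C(s)}` is the sure event. -/
lemma connAll_empty (s : V) : connAll ends s (∅ : Finset V) = Set.univ := by
  ext ω
  simp [connAll]

/-- Monotonicity of BHK 1.3 in the avoided set (cleared): `P(X; R_{T∪U}) P(R_T) ≤ P(X; R_T) P(R_{T∪U})`. -/
lemma shift_avoid_more (hp : IsProbVec p) (s : V) (A T U : Finset V) :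
    prob p (connAll ends s A ∩ avoidAll ends s (T ∪ U)) * prob p (avoidAll ends s T) ≤
      prob p (connAll ends s A ∩ avoidAll ends s T) * prob p (avoidAll ends s (T ∪ U)) := by
  have key := vdBK p hp ends s A ∅ (T ∪ U) T
  have h1 : (T ∪ U) ∩ T = T := by
    ext x; simp only [Finset.mem_inter, Finset.mem_union]; tauto
  have h2 : T ∪ U ∪ T = T ∪ U := by
    ext x; simp only [Finset.mem_union]; tauto
  rw [connAll_empty, Set.univ_inter, Finset.union_empty, h1, h2] at key
  exact key

/-- **Lemma A (avoid-more positivity, cleared)**: for every further avoided set `U`,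
`0 ≤ P(R_T)² P(XY; R_{T∪U}) − P(R_T) [P(X; R_T) P(Y; R_{T∪U}) + P(Y; R_T) P(X; R_{T∪U})]
   + P(X; R_T) P(Y; R_T) P(R_{T∪U})`. -/
theorem avoidMore_nonneg (hp : IsProbVec p) (s : V) (A B T U : Finset V) :
    0 ≤ prob p (avoidAll ends s T) ^ 2 *
          prob p (connAll ends s (A ∪ B) ∩ avoidAll ends s (T ∪ U)) -
        prob p (avoidAll ends s T) *
          (prob p (connAll ends s A ∩ avoidAll ends s T) *
              prob p (connAll ends s B ∩ avoidAll ends s (T ∪ U)) +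
            prob p (connAll ends s B ∩ avoidAll ends s T) *
              prob p (connAll ends s A ∩ avoidAll ends s (T ∪ U))) +
        prob p (connAll ends s A ∩ avoidAll ends s T) *
          prob p (connAll ends s B ∩ avoidAll ends s T) * prob p (avoidAll ends s (T ∪ U)) := by
  set P := prob p (avoidAll ends s T) with hP
  set PU := prob p (avoidAll ends s (T ∪ U)) with hPU
  set XY := prob p (connAll ends s (A ∪ B) ∩ avoidAll ends s (T ∪ U))
  set X0 := prob p (connAll ends s A ∩ avoidAll ends s T)
  set Y0 := prob p (connAll ends s B ∩ avoidAll ends s T)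
  set XU := prob p (connAll ends s A ∩ avoidAll ends s (T ∪ U))
  set YU := prob p (connAll ends s B ∩ avoidAll ends s (T ∪ U))
  -- BHK with the avoided set `T ∪ U`: `XU · YU ≤ XY · PU`
  have hbhk : XU * YU ≤ XY * PU := by
    have key := vdBK p hp ends s A B (T ∪ U) (T ∪ U)
    rw [Finset.inter_self, Finset.union_self] at key
    exact key
  -- the two shifts
  have hA := shift_avoid_more p ends hp s A T U
  have hB := shift_avoid_more p ends hp s B T U
  have hPU0 : 0 ≤ PU := prob_nonneg hp _
  have hXU0 : 0 ≤ XU := prob_nonneg hp _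
  have hYU0 : 0 ≤ YU := prob_nonneg hp _
  have hXY0 : 0 ≤ XY := prob_nonneg hp _
  have hXUle : XU ≤ PU := prob_mono hp Set.inter_subset_right
  have hYUle : YU ≤ PU := prob_mono hp Set.inter_subset_right
  have hXYle : XY ≤ PU := prob_mono hp Set.inter_subset_right
  rcases hPU0.lt_or_eq with hpos | hzero
  · have hid : PU * (P ^ 2 * XY - P * (X0 * YU + Y0 * XU) + X0 * Y0 * PU) =
        P ^ 2 * (PU * XY - XU * YU) + (XU * P - X0 * PU) * (YU * P - Y0 * PU) := by ring
    have h1 : 0 ≤ P ^ 2 * (PU * XY - XU * YU) := mul_nonneg (sq_nonneg _) (by linarith)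
    have h2 : 0 ≤ (XU * P - X0 * PU) * (YU * P - Y0 * PU) :=
      mul_nonneg_of_nonpos_of_nonpos (by linarith) (by linarith)
    have : 0 ≤ PU * (P ^ 2 * XY - P * (X0 * YU + Y0 * XU) + X0 * Y0 * PU) := by
      rw [hid]; linarith
    exact (mul_nonneg_iff_of_pos_left hpos).1 this
  · have hXUz : XU = 0 := le_antisymm (hzero ▸ hXUle) hXU0
    have hYUz : YU = 0 := le_antisymm (hzero ▸ hYUle) hYU0
    have hXYz : XY = 0 := le_antisymm (hzero ▸ hXYle) hXY0
    rw [hXUz, hYUz, hXYz, ← hzero]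
    ring_nf
    exact le_refl _

end MineCLemmas

end Summit.Ventures.PercRepro2
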